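import Literature.NumberTheory.EllipticCurves.SupersingularDensitySerreTraceProofs
import Literature.NumberTheory.EllipticCurves.NonEisensteinPrimeOfSurjective
import Literature.NumberTheory.EllipticCurves.HidaFamilyMembersProofs
import Literature.NumberTheory.EllipticCurves.CMTorsionIrreducibleOrdinaryProofs
import Literature.NumberTheory.GaloisRepresentations.ChebotarevCosetCyclotomic
import Literature.NumberTheory.GaloisRepresentations.ModNCyclotomicCharacter
import HarnessLib

/-!
# Route `KimAtThreeKolyvagin` (rung W2), crux `DeepLowerAtThreeOffKatoStratum` (item 19679), registered
# stub `stub_nonAdditive`, ROAD (b): the NON-EISENSTEIN NUMERAL — a prime `r ≡ 1 (mod n)`, `r ∤ 3nN_E`, with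
# `3 ∤ a_r(E) − r − 1`, from `ρ̄_{E,3}` SURJECTIVE, by the tree's PROVED Chebotarev density theorem

Cell `bsd-addord`, seat `bsd-addord-w2-acc2` (PROGRAMME PART 1b, ACCEL-LIST row (2)), gen 5; item
`stmt-BirchSwinnertonDyer-19679` (OWNER w2-c2 assembles; `--supports`, closes nothing). The ROAD (b) row theorems
(`…LevelLoweringRibetRows`, `…VatsalIharaRows`) display ONE numeral: a prime `r₀ ∤ Mq`, `r₀ ≡ 1 (mod Mq)`, with
`3 ∤ a_{r₀}(E) − r₀ − 1` (so that the reduced Hecke eigencharacter of Ribet's `g` is not Eisenstein in the sense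
of Darmon–Diamond–Taylor p. 120, and the canonical period exists, `…CanonicalPeriod`). THIS FILE produces it
from the surjectivity of `ρ̄_{E,3}` — theorems only, no definition, no named fact, no `sorry`:

* §1 `exists_commutator_smul_eq_neg` — for `ρ̄_{E,3} : Γ_ℚ → Aut E[3] ≅ GL₂(𝔽₃)` SURJECTIVE there are
  `a, b ∈ Γ_ℚ` whose commutator `[a, b] = aba⁻¹b⁻¹` acts on `E[3]` as `−1` (in a frame `E[3] ≅ 𝔽₃²`:
  `A = (0 −1; 1 0)`, `B = (1 1; 1 −1)` generate the quaternion group `Q₈ ⊂ SL₂(𝔽₃)` and `[A, B] = (AB)² = −1`).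
  A commutator lies in the kernel of EVERY character of `Γ_ℚ` — in particular of the mod-`n` cyclotomic
  character, whatever `n`.
* §2 ★ `exists_prime_one_mod_not_dvd_frobeniusTrace_sub` — **for `W/ℚ` elliptic, globally minimal, with
  `ρ̄_{E,3}` surjective, and `n ≥ 1`: there is a prime `r ≠ 3`, `r ∤ n`, `r ∤ N_E`, `r ≡ 1 (mod n)` with
  `3 ∤ a_r(E) − (r + 1)`.** Chebotarev (existence form, degree-one places, for the OPEN NORMAL subgroup
  `ker ρ̄_{E,3} ∩ ker χ̄_n`, PROVED in the tree: `infinite_setOf_prime_absNorm_frobenius_mul_inv_mem`) at the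
  commutator `σ` of §1 gives infinitely many `r` with a Frobenius `Φ ≡ σ`: then `χ̄_n(Φ) = χ̄_n(σ) = 1` reads
  `r ≡ 1 (mod n)` (`modNCyclotomicCharacter_eq_residueCard_of_isArithFrobAt`), and
  `tr ρ̄_{E,3}(Φ) = tr(−1) = −2 ≡ 1` reads `a_r(E) ≡ 1 (mod 3)` (`trace_galoisRepTorsion_frobenius_eq`, Serre 1981
  (238)), whence `a_r − r − 1 ≡ −r ≢ 0`. The finitely many `r ∣ 3nN_E` are discarded.

## References

* J. Tate, *Global class field theory*, in Cassels–Fröhlich (1967), Ch. VII §2.4 (Tchebotarev). [TateGCFT1967]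
* J.-P. Serre, *Propriétés galoisiennes des points d'ordre fini des courbes elliptiques*, Invent. Math. 15 (1972),
  §4; *Quelques applications du théorème de densité de Chebotarev*, Publ. IHÉS 54 (1981), §8.1 (238). [Serre1972]
  [Serre1981]
* H. Darmon, F. Diamond, R. Taylor, *Fermat's Last Theorem* (1995), §4.3 p. 120 (Eisenstein ideals).
  [DarmonDiamondTaylor1995]
-/

set_option autoImplicit false
-- the Theorems namespace of a single-conjunct summit repeats the summit name by design (D-0017)
set_option linter.dupNamespace false

noncomputable section

open scoped Classical NumberField

open WeierstrassCurve NumberField IsDedekindDomain Field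
  Literature.NumberTheory.EllipticCurves Literature.NumberTheory.GaloisRepresentations

namespace Summit.BirchSwinnertonDyer.BirchSwinnertonDyer.Theorems.KimAtThreeDeepLowerOffStratumLevelLoweringNonEisensteinPrime

/-! ### §1 A commutator of `Γ_ℚ` acting on `E[3]` as `−1` -/

section Commutator

variable (W : WeierstrassCurve ℚ) [W.IsElliptic]

/-- **For `ρ̄_{E,3}` surjective, some commutator `aba⁻¹b⁻¹ ∈ Γ_ℚ` acts on `E[3]` as `−1`** (in a frame
`E[3] ≅ 𝔽₃²`, `A = (0 −1; 1 0)` and `B = (1 1; 1 −1)` satisfy `ABA⁻¹B⁻¹ = (AB)² = −1`: the quaternion group in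
`SL₂(𝔽₃)`). [cite: Serre1972, §4] -/
theorem exists_commutator_smul_eq_neg (hsurj : W.HasSurjectiveModNGaloisRep ((3 : ℕ) : ℤ)) :
    ∃ a b : absoluteGaloisGroup ℚ, ∀ P : geomTorsion W ((3 : ℕ) : ℤ), (a * b * a⁻¹ * b⁻¹) • P = -P := by
  -- a frame `E[3] ≅ 𝔽₃²`
  have hcard : Nat.card (geomTorsion W ((3 : ℕ) : ℤ)) = 3 ^ 2 := W.natCard_geomTorsion_natCast (by norm_num)
  haveI : Finite (geomTorsion W ((3 : ℕ) : ℤ)) := Nat.finite_of_card_ne_zero (by rw [hcard]; norm_num)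
  obtain ⟨P₀, hP₀⟩ : ∃ P₀ : geomTorsion W ((3 : ℕ) : ℤ), P₀ ≠ 0 := by
    haveI : Nontrivial (geomTorsion W ((3 : ℕ) : ℤ)) := by
      rw [← Finite.one_lt_card_iff_nontrivial, hcard]; norm_num
    exact exists_ne 0
  obtain ⟨e, -⟩ := exists_addEquiv_apply_eq_single W 3 hP₀
  -- the two quaternion generators on `𝔽₃²`
  let A' : (Fin 2 → ZMod 3) ≃+ (Fin 2 → ZMod 3) :=
    { toFun := fun x => ![-x 1, x 0]
      invFun := fun x => ![x 1, -x 0]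
      left_inv := fun x => by revert x; decide
      right_inv := fun x => by revert x; decide
      map_add' := fun x y => by revert x y; decide }
  let B' : (Fin 2 → ZMod 3) ≃+ (Fin 2 → ZMod 3) :=
    { toFun := fun x => ![x 0 + x 1, x 0 - x 1]
      invFun := fun x => ![-x 0 - x 1, -x 0 + x 1]
      left_inv := fun x => by revert x; decide
      right_inv := fun x => by revert x; decide
      map_add' := fun x y => by revert x y; decide }
  have key : ∀ y : Fin 2 → ZMod 3, A' (B' (A'.symm (B'.symm y))) = -y := by decide
  -- transport and lift to `Γ_ℚ`
  let Aτ : geomTorsion W ((3 : ℕ) : ℤ) ≃+ geomTorsion W ((3 : ℕ) : ℤ) := e.trans (A'.trans e.symm)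
  let Bτ : geomTorsion W ((3 : ℕ) : ℤ) ≃+ geomTorsion W ((3 : ℕ) : ℤ) := e.trans (B'.trans e.symm)
  obtain ⟨a, ha⟩ := hsurj (Multiplicative.ofAdd Aτ)
  obtain ⟨b, hb⟩ := hsurj (Multiplicative.ofAdd Bτ)
  have haQ : ∀ Q, a • Q = Aτ Q := fun Q ↦ by
    rw [← galoisRepTorsion_apply W ((3 : ℕ) : ℤ) a Q, ha]; rfl
  have hbQ : ∀ Q, b • Q = Bτ Q := fun Q ↦ by
    rw [← galoisRepTorsion_apply W ((3 : ℕ) : ℤ) b Q, hb]; rfl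
  have haQ' : ∀ Q, a⁻¹ • Q = Aτ.symm Q := fun Q ↦ by
    symm; rw [AddEquiv.symm_apply_eq, ← haQ, smul_inv_smul]
  have hbQ' : ∀ Q, b⁻¹ • Q = Bτ.symm Q := fun Q ↦ by
    symm; rw [AddEquiv.symm_apply_eq, ← hbQ, smul_inv_smul]
  refine ⟨a, b, fun P ↦ ?_⟩
  rw [mul_smul, mul_smul, mul_smul, hbQ', haQ', hbQ, haQ]
  change e.symm (A' (e (e.symm (B' (e (e.symm (A'.symm (e (e.symm (B'.symm (e P))))))))))) = -P
  rw [e.apply_symm_apply, e.apply_symm_apply, e.apply_symm_apply, key, map_neg, e.symm_apply_apply]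

end Commutator

/-! ### §2 ★ The numeral: a prime `r ≡ 1 (mod n)` with `3 ∤ a_r(E) − r − 1` -/

section Numeral

open Rat.HeightOneSpectrum

/-- `N v = p_v` for a finite place `v` of `ℚ` (reproved, as in the tree's Bcgp/Artin files, to keep imports light).
[folklore] -/
theorem residueCard_eq_primesEquiv (v : HeightOneSpectrum (𝓞 ℚ)) :
    v.residueCard = (primesEquiv v : ℕ) := by
  have h : Ideal.span {(natGenerator v : ℤ)} =
      v.asIdeal.map (Rat.IsIntegralClosure.intEquiv (𝓞 ℚ) : 𝓞 ℚ →+* ℤ) :=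
    span_natGenerator v
  rw [v.residueCard_eq_card_quotient, Nat.card_congr ((Ideal.quotientEquiv _ _
    (Rat.IsIntegralClosure.intEquiv (𝓞 ℚ)) h).trans (Int.quotientSpanNatEquivZMod _)).toEquiv,
    Nat.card_zmod]
  rfl

/-- The finitely many places of `ℚ` whose prime divides a fixed `m ≠ 0`. [folklore] -/
theorem finite_setOf_primesEquiv_dvd {m : ℕ} (hm : m ≠ 0) :
    {v : HeightOneSpectrum (𝓞 ℚ) | (primesEquiv v : ℕ) ∣ m}.Finite := by
  have hinj : Function.Injective (fun v : HeightOneSpectrum (𝓞 ℚ) ↦ (primesEquiv v : ℕ)) :=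
    fun v w h ↦ primesEquiv.injective (Subtype.ext h)
  have : {v : HeightOneSpectrum (𝓞 ℚ) | (primesEquiv v : ℕ) ∣ m} =
      (fun v : HeightOneSpectrum (𝓞 ℚ) ↦ (primesEquiv v : ℕ)) ⁻¹' (m.divisors : Set ℕ) := by
    ext v
    simp only [Set.mem_setOf_eq, Set.mem_preimage, Finset.mem_coe, Nat.mem_divisors]
    exact ⟨fun h ↦ ⟨h, hm⟩, fun h ↦ h.1⟩
  rw [this]
  exact (Finset.finite_toSet _).preimage hinj.injOn

variable (W : WeierstrassCurve ℚ) [W.IsElliptic] [W.IsGloballyMinimal]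

/-- ★ **The non-Eisenstein numeral from `ρ̄_{E,3}` surjective, by Chebotarev.** For `W/ℚ` elliptic and globally
minimal with `ρ̄_{E,3} : Γ_ℚ → Aut E[3]` surjective and `n ≥ 1`, there is a prime `r` with `r ≠ 3`, `r ∤ n`,
`r ∤ N_E`, `r ≡ 1 (mod n)` and `3 ∤ a_r(E) − (r + 1)` (`a_r(E) = W.frobeniusTrace r`). Proof: Chebotarev
(`infinite_setOf_prime_absNorm_frobenius_mul_inv_mem`, PROVED in the tree) for the open normal subgroup
`ker (ρ̄_{E,3} × χ̄_n)` at the commutator `σ` of §1: a Frobenius `Φ ≡ σ` has `χ̄_n(Φ) = χ̄_n(σ) = 1`, i.e.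
`r ≡ 1 (mod n)`, and `tr ρ̄(Φ) = tr(−1) = −2`, i.e. `a_r ≡ 1 (mod 3)`, so `a_r − r − 1 ≡ −r ≢ 0`.
[cite: TateGCFT1967, §2.4 (Tchebotarev density theorem) with Prop. 2.3] [cite: Serre1981, §8.1 eq. (238) (p. 188)]
[cite: DarmonDiamondTaylor1995, §4.3 (p. 120)] -/
theorem exists_prime_one_mod_not_dvd_frobeniusTrace_sub (hsurj : W.HasSurjectiveModNGaloisRep ((3 : ℕ) : ℤ))
    (n : ℕ) [NeZero n] :
    ∃ r : ℕ, r.Prime ∧ r ≠ 3 ∧ ¬ r ∣ n ∧ ¬ r ∣ W.conductorNorm ℤ ∧ r ≡ 1 [MOD n] ∧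
      ¬ (3 : ℤ) ∣ W.frobeniusTrace r - (r + 1) := by
  letI : Module (ZMod 3) (geomTorsion W ((3 : ℕ) : ℤ)) := AddSubgroup.torsionBy.zmodModule
  haveI : Finite (geomTorsion W ((3 : ℕ) : ℤ)) :=
    Nat.finite_of_card_ne_zero (by rw [W.natCard_geomTorsion_natCast (by norm_num)]; norm_num)
  haveI : Module.Finite (ZMod 3) (geomTorsion W ((3 : ℕ) : ℤ)) := Module.Finite.of_finite
  haveI : NeZero (n : ℚ) := NeZero.charZero
  -- §1: the commutator `σ`
  obtain ⟨a, b, hσ⟩ := exists_commutator_smul_eq_neg W hsurj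
  set σ : absoluteGaloisGroup ℚ := a * b * a⁻¹ * b⁻¹ with hσdef
  -- the open normal subgroup `ker (ρ̄ × χ̄_n)`
  set τ := galoisRepTorsion W ((3 : ℕ) : ℤ) with hτdef
  set χ : absoluteGaloisGroup ℚ →* (ZMod n)ˣ := modNCyclotomicCharacter ℚ n with hχdef
  set N₀ : Subgroup (absoluteGaloisGroup ℚ) := (τ.prod χ).ker with hN₀def
  haveI : N₀.Normal := MonoidHom.normal_ker _
  have hNmem : ∀ γ : absoluteGaloisGroup ℚ, γ ∈ N₀ ↔ τ γ = 1 ∧ χ γ = 1 := fun γ ↦ by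
    rw [hN₀def, MonoidHom.mem_ker, MonoidHom.prod_apply, Prod.mk_eq_one]
  have hχopen : IsOpen (χ.ker : Set (absoluteGaloisGroup ℚ)) := by
    refine Subgroup.isOpen_of_mem_nhds χ.ker (g := 1) ?_
    exact (modNCyclotomicCharacter_eventually_eq_one ℚ n).mono fun γ hγ ↦ (MonoidHom.mem_ker).mpr hγ
  have hτopen : IsOpen (τ.ker : Set (absoluteGaloisGroup ℚ)) :=
    isOpen_ker_galoisRepTorsion_holds W (n := ((3 : ℕ) : ℤ)) (by norm_num)
  have hN₀ : IsOpen (N₀ : Set (absoluteGaloisGroup ℚ)) := by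
    have hNeq : (N₀ : Set (absoluteGaloisGroup ℚ)) =
        (τ.ker : Set (absoluteGaloisGroup ℚ)) ∩ (χ.ker : Set (absoluteGaloisGroup ℚ)) := by
      ext γ
      simp only [SetLike.mem_coe, Set.mem_inter_iff, MonoidHom.mem_ker, hNmem]
    rw [hNeq]
    exact hτopen.inter hχopen
  -- `χ̄_n(σ) = 1` (a commutator) and `ρ̄(σ)` acts as `−1`
  have hχσ : χ σ = 1 := by
    rw [hσdef, map_mul, map_mul, map_mul, map_inv, map_inv, mul_inv_cancel_comm, mul_inv_cancel]
  -- Chebotarev, discarding the places above `3 n N_E`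
  have hm : 3 * n * W.conductorNorm ℤ ≠ 0 :=
    mul_ne_zero (mul_ne_zero (by norm_num) (NeZero.ne n)) (W.conductorNorm_pos_holds).ne'
  obtain ⟨v, ⟨-, -, 𝔓, h𝔓, Φ, hΦ, hmem⟩, hv⟩ :=
    ((infinite_setOf_prime_absNorm_frobenius_mul_inv_mem N₀ hN₀ σ).sdiff
      (finite_setOf_primesEquiv_dvd hm)).nonempty
  simp only [Set.mem_setOf_eq] at hv
  set r : ℕ := (primesEquiv v : ℕ) with hrdef
  have hr : r.Prime := (primesEquiv v).2
  haveI : Fact r.Prime := ⟨hr⟩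
  have hr3 : r ≠ 3 := by
    intro h; apply hv; rw [h]; exact dvd_mul_of_dvd_left (dvd_mul_right 3 n) _
  have hrn : ¬ r ∣ n := fun h ↦ hv (dvd_mul_of_dvd_left (dvd_mul_of_dvd_right h 3) _)
  have hrN : ¬ r ∣ W.conductorNorm ℤ := fun h ↦ hv (dvd_mul_of_dvd_right h _)
  obtain ⟨hτ1, hχ1⟩ := (hNmem _).mp hmem
  have hτeq : τ Φ = τ σ := mul_inv_eq_one.mp (by rwa [← map_inv, ← map_mul])
  have hχeq : χ Φ = χ σ := mul_inv_eq_one.mp (by rwa [← map_inv, ← map_mul])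
  -- `r ≡ 1 (mod n)`
  haveI : 𝔓.IsPrime := h𝔓.1
  have hn𝔓 : (n : absIntegers (𝓞 ℚ) ℚ) ∉ 𝔓 := Rat.natCast_not_mem_of_mem_primesAbove_of_not_dvd h𝔓 hrn
  have hmod : r ≡ 1 [MOD n] := by
    have hval := modNCyclotomicCharacter_eq_residueCard_of_isArithFrobAt (K := ℚ) (N := n) h𝔓 hn𝔓 hΦ
    rw [← hχdef, hχeq, hχσ, Units.val_one, residueCard_eq_primesEquiv, ← hrdef] at hval
    have : ((r : ℕ) : ZMod n) = ((1 : ℕ) : ZMod n) := by rw [Nat.cast_one]; exact hval.symm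
    exact (ZMod.natCast_eq_natCast_iff _ _ _).mp this
  -- `a_r ≡ 1 (mod 3)`
  have hgood : W.HasGoodReductionAtPrime r := hasGoodReductionAtPrime_of_not_dvd_conductorNorm W hrN
  have htr := W.trace_galoisRepTorsion_frobenius_eq 3 (p := r) hr3 hgood (v := v) rfl h𝔓 hΦ
  have hlin : (galoisRepTorsion W ((3 : ℕ) : ℤ) Φ).toAdd.toAddMonoidHom.toZModLinearMap 3 =
      -LinearMap.id := by
    apply LinearMap.ext
    intro P
    rw [AddMonoidHom.coe_toZModLinearMap, LinearMap.neg_apply, LinearMap.id_apply]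
    change (galoisRepTorsion W ((3 : ℕ) : ℤ) Φ).toAdd P = -P
    rw [← hτdef, hτeq, hτdef, galoisRepTorsion_apply]
    exact hσ P
  have ha1 : (W.frobeniusTrace r : ZMod 3) = -2 := by
    rw [← htr, hlin, map_neg, LinearMap.trace_id, W.finrank_zmod_geomTorsion_eq_two 3]
    norm_num
  refine ⟨r, hr, hr3, hrn, hrN, hmod, fun hdvd ↦ ?_⟩
  -- `3 ∣ a_r − r − 1` and `3 ∣ a_r − 1` give `3 ∣ r`
  have h1 : (3 : ℤ) ∣ W.frobeniusTrace r - 1 := by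
    have h := (ZMod.intCast_zmod_eq_zero_iff_dvd (W.frobeniusTrace r - 1) 3).mp (by
      push_cast
      rw [ha1]
      decide)
    exact_mod_cast h
  have h3r : (3 : ℤ) ∣ (r : ℤ) := by
    have := dvd_sub h1 hdvd
    rw [show W.frobeniusTrace r - 1 - (W.frobeniusTrace r - (r + 1)) = (r : ℤ) by ring] at this
    exact this
  have : 3 ∣ r := by exact_mod_cast h3r
  exact hr3 ((Nat.prime_dvd_prime_iff_eq Nat.prime_three hr).mp this).symm

end Numeral

end Summit.BirchSwinnertonDyer.BirchSwinnertonDyer.Theorems.KimAtThreeDeepLowerOffStratumLevelLoweringNonEisensteinPrime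

end
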